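import Mathlib
import Summits.Ventures.PercRepro2.Defs
import Summits.Ventures.PercRepro2.CoinTraceBlock

/-!
# The two positive-association inputs of a trace law, packaged, and the SHIFT lemmas (blind
cell PercRepro2, night-2 g3; proofs/NIGHT2-DARC.md §17)

`TracePA P μ`: (AV-PA) of the trace law `μ` on `P.powerset` — for every `U ⊆ P` and every pair of
functionals monotone and nonnegative on the subsets of `P`, the cleared positive-association
inequality on the avoidance family `{Z : Z ∩ U = ∅}` (what `trace_pa` delivers for the trace law
of a pendant set).  `TraceCUPA P μ v`: the same on the cylinder family `{Z ∋ v}` (`trace_cu_pa`).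
From (AV-PA) alone, against the indicator of «`Z` meets `U`» / «`v ∈ Z`», follow the SHIFTS of a
decreasing `x ≤ 1`: `MX · μ(𝒩_U) ≤ Σ_{𝒩_U} x μ · Λ` (`shift_avoid_of_tracePA`) and
`Σ_{Z ∋ v} x μ · Λ ≤ MX · μ({Z ∋ v})` (`shift_mem_of_tracePA`) — the two signs of the shift
terms in NIGHT2-DARC.md §15.7–15.8.
-/

namespace Summit.Ventures.PercRepro2.Coin

section Sums

variable {V : Type*} {R : Type*} [CommRing R]

/-- Indicator sums are sums over the filter. -/
lemma sum_ite_mul_eq_sum_filter (S : Finset (Finset V)) (p : Finset V → Prop) [DecidablePred p]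
    (g : Finset V → R) :
    ∑ Z ∈ S, (if p Z then (1 : R) else 0) * g Z = ∑ Z ∈ S.filter p, g Z := by
  rw [Finset.sum_filter]
  refine Finset.sum_congr rfl fun Z _ => ?_
  split_ifs <;> simp

end Sums

section Shift

open Classical

variable {V : Type*} [DecidableEq V] {R : Type*} [Field R] [LinearOrder R] [IsStrictOrderedRing R]

/-- (AV-PA) of a trace law on a family `P.powerset`, packaged: for every `U ⊆ P` and every pair
of functionals monotone and nonnegative on the subsets of `P`. -/
def TracePA (P : Finset V) (μ : Finset V → R) : Prop :=
  ∀ U : Finset V, U ⊆ P → ∀ f₁ f₂ : Finset V → R,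
    (∀ Z Z' : Finset V, Z ⊆ Z' → Z' ⊆ P → f₁ Z ≤ f₁ Z') →
    (∀ Z Z' : Finset V, Z ⊆ Z' → Z' ⊆ P → f₂ Z ≤ f₂ Z') →
    (∀ Z : Finset V, Z ⊆ P → 0 ≤ f₁ Z) → (∀ Z : Finset V, Z ⊆ P → 0 ≤ f₂ Z) →
    (∑ Z ∈ P.powerset.filter (fun Z => Disjoint Z U), f₁ Z * μ Z) *
        (∑ Z ∈ P.powerset.filter (fun Z => Disjoint Z U), f₂ Z * μ Z) ≤
      (∑ Z ∈ P.powerset.filter (fun Z => Disjoint Z U), f₁ Z * f₂ Z * μ Z) *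
        ∑ Z ∈ P.powerset.filter (fun Z => Disjoint Z U), μ Z

/-- (CU-PA) of a trace law at the leaf `v`: the same inequality on the cylinder family `{Z ∋ v}`. -/
def TraceCUPA (P : Finset V) (μ : Finset V → R) (v : V) : Prop :=
  ∀ f₁ f₂ : Finset V → R,
    (∀ Z Z' : Finset V, Z ⊆ Z' → Z' ⊆ P → f₁ Z ≤ f₁ Z') →
    (∀ Z Z' : Finset V, Z ⊆ Z' → Z' ⊆ P → f₂ Z ≤ f₂ Z') →
    (∀ Z : Finset V, Z ⊆ P → 0 ≤ f₁ Z) → (∀ Z : Finset V, Z ⊆ P → 0 ≤ f₂ Z) →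
    (∑ Z ∈ P.powerset.filter (fun Z => v ∈ Z), f₁ Z * μ Z) *
        (∑ Z ∈ P.powerset.filter (fun Z => v ∈ Z), f₂ Z * μ Z) ≤
      (∑ Z ∈ P.powerset.filter (fun Z => v ∈ Z), f₁ Z * f₂ Z * μ Z) *
        ∑ Z ∈ P.powerset.filter (fun Z => v ∈ Z), μ Z

/-- The trivial filter `Disjoint Z ∅` is the whole family. -/
lemma filter_disjoint_empty (P : Finset V) :
    P.powerset.filter (fun Z => Disjoint Z (∅ : Finset V)) = P.powerset :=
  Finset.filter_true_of_mem fun Z _ => Finset.disjoint_empty_right Z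

omit [DecidableEq V] [LinearOrder R] [IsStrictOrderedRing R] in
/-- `Σ (1 − x) μ = Σ μ − Σ x μ` over any family. -/
lemma sum_one_sub_mul (S : Finset (Finset V)) (x μ : Finset V → R) :
    ∑ Z ∈ S, (1 - x Z) * μ Z = ∑ Z ∈ S, μ Z - ∑ Z ∈ S, x Z * μ Z := by
  rw [← Finset.sum_sub_distrib]
  exact Finset.sum_congr rfl fun Z _ => by ring

/-- **The shift on an avoidance family** (`x` decreasing, `≤ 1`; from (AV-PA) on the whole
family against the indicator of «`Z` meets `U`»): `MX · μ(𝒩_U) ≤ Σ_{𝒩_U} x μ · Λ`. -/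
lemma shift_avoid_of_tracePA (P : Finset V) (μ x : Finset V → R) (hPA : TracePA P μ)
    (hx1 : ∀ Z : Finset V, Z ⊆ P → x Z ≤ 1)
    (hxanti : ∀ Z Z' : Finset V, Z ⊆ Z' → Z' ⊆ P → x Z' ≤ x Z) (U : Finset V) :
    (∑ Z ∈ P.powerset, x Z * μ Z) * ∑ Z ∈ P.powerset.filter (fun Z => Disjoint Z U), μ Z ≤
      (∑ Z ∈ P.powerset.filter (fun Z => Disjoint Z U), x Z * μ Z) * ∑ Z ∈ P.powerset, μ Z := by
  have h := hPA ∅ (Finset.empty_subset P) (fun Z => 1 - x Z)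
    (fun Z => if Disjoint Z U then 0 else 1)
    (fun Z Z' hZZ' hZ'P => by
      show 1 - x Z ≤ 1 - x Z'
      linarith [hxanti Z Z' hZZ' hZ'P])
    (fun Z Z' hZZ' _ => by
      show (if Disjoint Z U then (0 : R) else 1) ≤ if Disjoint Z' U then 0 else 1
      by_cases hZ' : Disjoint Z' U
      · have hZ : Disjoint Z U := Finset.disjoint_of_subset_left hZZ' hZ'
        rw [if_pos hZ, if_pos hZ']
      · rw [if_neg hZ']
        split_ifs <;> norm_num)
    (fun Z hZ => by show 0 ≤ 1 - x Z; linarith [hx1 Z hZ])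
    (fun Z _ => by
      show 0 ≤ if Disjoint Z U then (0 : R) else 1
      split_ifs <;> norm_num)
  simp only [filter_disjoint_empty] at h
  -- the three sums
  have e1 : ∑ Z ∈ P.powerset, (1 - x Z) * μ Z =
      ∑ Z ∈ P.powerset, μ Z - ∑ Z ∈ P.powerset, x Z * μ Z := sum_one_sub_mul _ _ _
  have hsplit := Finset.sum_filter_add_sum_filter_not P.powerset (fun Z => Disjoint Z U) μ
  have hsplitx := Finset.sum_filter_add_sum_filter_not P.powerset (fun Z => Disjoint Z U)
    (fun Z => x Z * μ Z)
  have e2 : ∑ Z ∈ P.powerset, (if Disjoint Z U then (0 : R) else 1) * μ Z =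
      ∑ Z ∈ P.powerset.filter (fun Z => ¬ Disjoint Z U), μ Z := by
    rw [Finset.sum_filter]
    refine Finset.sum_congr rfl fun Z _ => ?_
    split_ifs <;> simp
  have e3 : ∑ Z ∈ P.powerset, (1 - x Z) * (if Disjoint Z U then (0 : R) else 1) * μ Z =
      ∑ Z ∈ P.powerset.filter (fun Z => ¬ Disjoint Z U), μ Z
        - ∑ Z ∈ P.powerset.filter (fun Z => ¬ Disjoint Z U), x Z * μ Z := by
    rw [← sum_one_sub_mul, Finset.sum_filter]
    refine Finset.sum_congr rfl fun Z _ => ?_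
    split_ifs <;> simp
  rw [e1, e2, e3] at h
  have key : (∑ Z ∈ P.powerset.filter (fun Z => ¬ Disjoint Z U), μ Z
        - ∑ Z ∈ P.powerset.filter (fun Z => ¬ Disjoint Z U), x Z * μ Z) * ∑ Z ∈ P.powerset, μ Z
      - (∑ Z ∈ P.powerset, μ Z - ∑ Z ∈ P.powerset, x Z * μ Z) *
        ∑ Z ∈ P.powerset.filter (fun Z => ¬ Disjoint Z U), μ Z
      = (∑ Z ∈ P.powerset.filter (fun Z => Disjoint Z U), x Z * μ Z) * ∑ Z ∈ P.powerset, μ Z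
        - (∑ Z ∈ P.powerset, x Z * μ Z) *
          ∑ Z ∈ P.powerset.filter (fun Z => Disjoint Z U), μ Z := by
    rw [← hsplit, ← hsplitx]
    ring
  linarith [h, key]

/-- **The shift on a cylinder family** (`x` decreasing, `≤ 1`; from (AV-PA) on the whole family
against the indicator of `v ∈ Z`): `Σ_{Z ∋ v} x μ · Λ ≤ MX · μ({Z ∋ v})`. -/
lemma shift_mem_of_tracePA (P : Finset V) (μ x : Finset V → R) (hPA : TracePA P μ)
    (hx1 : ∀ Z : Finset V, Z ⊆ P → x Z ≤ 1)
    (hxanti : ∀ Z Z' : Finset V, Z ⊆ Z' → Z' ⊆ P → x Z' ≤ x Z) (v : V) :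
    (∑ Z ∈ P.powerset.filter (fun Z => v ∈ Z), x Z * μ Z) * ∑ Z ∈ P.powerset, μ Z ≤
      (∑ Z ∈ P.powerset, x Z * μ Z) * ∑ Z ∈ P.powerset.filter (fun Z => v ∈ Z), μ Z := by
  have h := hPA ∅ (Finset.empty_subset P) (fun Z => 1 - x Z)
    (fun Z => if v ∈ Z then 1 else 0)
    (fun Z Z' hZZ' hZ'P => by
      show 1 - x Z ≤ 1 - x Z'
      linarith [hxanti Z Z' hZZ' hZ'P])
    (fun Z Z' hZZ' _ => by
      show (if v ∈ Z then (1 : R) else 0) ≤ if v ∈ Z' then 1 else 0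
      by_cases hZ : v ∈ Z
      · rw [if_pos hZ, if_pos (hZZ' hZ)]
      · rw [if_neg hZ]
        split_ifs <;> norm_num)
    (fun Z hZ => by show 0 ≤ 1 - x Z; linarith [hx1 Z hZ])
    (fun Z _ => by
      show 0 ≤ if v ∈ Z then (1 : R) else 0
      split_ifs <;> norm_num)
  simp only [filter_disjoint_empty] at h
  have e1 : ∑ Z ∈ P.powerset, (1 - x Z) * μ Z =
      ∑ Z ∈ P.powerset, μ Z - ∑ Z ∈ P.powerset, x Z * μ Z := sum_one_sub_mul _ _ _
  have e2 : ∑ Z ∈ P.powerset, (if v ∈ Z then (1 : R) else 0) * μ Z =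
      ∑ Z ∈ P.powerset.filter (fun Z => v ∈ Z), μ Z := sum_ite_mul_eq_sum_filter _ _ _
  have e3 : ∑ Z ∈ P.powerset, (1 - x Z) * (if v ∈ Z then (1 : R) else 0) * μ Z =
      ∑ Z ∈ P.powerset.filter (fun Z => v ∈ Z), μ Z
        - ∑ Z ∈ P.powerset.filter (fun Z => v ∈ Z), x Z * μ Z := by
    rw [← sum_one_sub_mul, Finset.sum_filter]
    refine Finset.sum_congr rfl fun Z _ => ?_
    split_ifs <;> simp
  rw [e1, e2, e3] at h
  have key : (∑ Z ∈ P.powerset.filter (fun Z => v ∈ Z), μ Z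
        - ∑ Z ∈ P.powerset.filter (fun Z => v ∈ Z), x Z * μ Z) * ∑ Z ∈ P.powerset, μ Z
      - (∑ Z ∈ P.powerset, μ Z - ∑ Z ∈ P.powerset, x Z * μ Z) *
        ∑ Z ∈ P.powerset.filter (fun Z => v ∈ Z), μ Z
      = (∑ Z ∈ P.powerset, x Z * μ Z) * ∑ Z ∈ P.powerset.filter (fun Z => v ∈ Z), μ Z
        - (∑ Z ∈ P.powerset.filter (fun Z => v ∈ Z), x Z * μ Z) * ∑ Z ∈ P.powerset, μ Z := by
    ring
  linarith [h, key]


end Shift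

end Summit.Ventures.PercRepro2.Coin
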